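import Mathlib.Algebra.Order.BigOperators.Group.Finset
import Mathlib.Algebra.Order.Group.Abs
import Mathlib.Data.Real.Basic
import Mathlib.Data.Int.Interval
import Mathlib.Data.Fintype.Pi
import Mathlib.Tactic.Group
import Mathlib.Analysis.SpecialFunctions.Pow.Real
import Mathlib.Analysis.SpecialFunctions.Pow.NNReal
import Mathlib.Analysis.SpecificLimits.Normed
import Literature.Combinatorics.Additive.BorderTricoloredSumFree
import Literature.Computability.AlgebraicComplexity.GroupTheoreticMatMulThmBProofs
import Literature.RepresentationTheory.FiniteGroups.WedderburnBlocks
import Literature.Barriers.MatrixMultiplication.NilpotentGroupBarrier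
import HarnessLib

/-!
# From STPP constructions to multiplicative matchings in powers: BCCGU 2017, Thm. 2.8, Thm. 2.9 and Cor. 2.11 — proved

Topic `Literature/Barriers/MatrixMultiplication`; second proof file attached to the catalogue entry
`NilpotentGroupBarrier.lean`, discharging its named fact `BCCGU2017_cor211`
(Blasiak–Church–Cohn–Grochow–Umans 2017, Cor. 2.11 "Key corollary", effective reading for one
group together with all its powers) as `BCCGU2017_cor211_holds`, and providing the engine
"STPP construction violating (2.2) at `2 + ε` ⟹ near-perfect multiplicative matchings in a
power" that the discharge of Cor. 3.20 will also use.

Sources.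
* J. Blasiak, T. Church, H. Cohn, J. A. Grochow, C. Umans, *Which groups are amenable to
  proving exponent two for matrix multiplication?*, arXiv:1712.02302 [BlasiakChurchCohnGrochowUmans2017],
  §2.3: Thm. 2.8 ("Any family of STPP constructions that does not meet the packing bound cannot
  imply `ω = 2` via Inequality (2.2)" = BCCGNSU Lemma 2.4), Thm. 2.9 ("Any family of STPP
  constructions in groups `G` with `|G| → ∞` that meets the packing bound implies the existence
  of multiplicative matchings in `G^N` with cardinality `|G|^{N(1-ε)}` …", "proved in
  [BCCGNSU]"), Prop. 2.10, Cor. 2.11 (p. 4–5 of the held text `paper:arxiv-1712.02302`).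
* J. Blasiak, T. Church, H. Cohn, J. A. Grochow, E. Naslund, W. F. Sawin, C. Umans, *On cap sets
  and the group-theoretic approach to matrix multiplication*, Discrete Analysis 2017:3,
  arXiv:1605.06702 [BlasiakChurchCohnGrochowNaslundSawinUmans2017]: packing bounds (§2, p. 5),
  Def. 3.2, Thm. 3.3 (p. 7), Lemma 3.4, Lemma 3.5 (p. 8), §3.2 (p. 9) of the held text.

## Content and proof

This is the MULTIPLICATIVE (arbitrary finite group) version of the tree's abelian development
`BorderTricoloredSumFree.lean` + `GroupTheoreticMatMulThmBProofs.lean` (which proves BCCGNSU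
Thm. B); the proofs are the same with the CKSU relation `a a'⁻¹ b b'⁻¹ c c'⁻¹ = 1`
(`SimultaneousTPP`, CKSU Def. 5.1) handled by conjugation instead of commutativity.

* STPP algebra in any group: `SimultaneousTPP.rotate/prod/pi/comp` (CKSU §5, BCCGNSU proof of
  Lemma 3.5) and the per-triple packing `(|A||B||C|)² ≤ |G|³`
  (`TripleProductProperty.card_mul_sq_le`, from the three injections of the packing bounds).
* `IsBorderMulMatching` (Def. 3.2, multiplicative, functional form), its powers (`.pi`) and
  **Lemma 3.4** (`.exists_isMulMatching_pi`: a matching in `G^N` indexed by `M ⊆ ι^N`,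
  `|ι|^N ≤ (2NR+1)²|M|`).
* **Thm. 3.3 in any finite group** (`SimultaneousTPP.exists_isBorderMulMatching`): the families
  `c⁻¹a, a⁻¹b, b⁻¹c` on `Mᵢ = {(a,b,c) ∈ Aᵢ×Bᵢ×Cᵢ : ρ(a)+ρ(b)+ρ(c) = rᵢ}` with the
  square-completing weights form a border multiplicative matching of size
  `≥ Σᵢ |Aᵢ||Bᵢ||Cᵢ|/(|Aᵢ|+|Bᵢ|+|Cᵢ|)`.
* **§3.2 / Lemma 3.5 made effective** (`SimultaneousTPP.card_mul_sq_le`,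
  `.card_fiber_pow_three_mul_sq_le`, `.sum_rpow_le_of_matching_bound`): if every multiplicative
  matching in `((H^N)^3)^{N'}` has size `≤ 3 (Y^{3N})^{N'}`, then every STPP family in `H` has
  `Σᵢ (|Aᵢ||Bᵢ||Cᵢ|)^{2/3} ≤ Y` (tensor power, words grouped by type, symmetrised uniform square
  sub-families in `(H^N)^3`, `N → ∞`). This is Thm. 2.9 read effectively.
* **Prop. 2.10 in powers** (`card_le_of_sliceRank_pow_le`): `slice-rank D_{G^M} ≤ |G|^{M(1-δ)}`
  for `M ≥ 1` bounds matchings in `((G^N)^3)^{N'}` by `3((|G|^{1-δ})^{3N})^{N'}` (transport along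
  the injective homomorphism `((G^N)^3)^{N'} → G^{Fin 3NN'}`).
* **Thm. 2.8 step** (`sum_rpow_le_charDegreePowSum_of_sum_rpow_le`): from
  `Σ mᵢ^{2/3} ≤ |G|^{1-δ}` and `mᵢ² ≤ |G|³` to `Σ mᵢ^{(2+2δ)/3} ≤ |G| ≤ Σⱼ dⱼ^{2+2δ}`
  (`card_le_charDegreePowSum`, from the Wedderburn blocks of `ℂ[G]`, `WedderburnBlocks.lean`).
* `BCCGU2017_cor211_holds` (`ε = 2δ`).
-/

noncomputable section

namespace Literature.Barriers.MatrixMultiplication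

open Finset Literature.Combinatorics.Additive Literature.RepresentationTheory.FiniteGroups
open Literature.Computability.AlgebraicComplexity.Combinatorics

universe u v

/-! ## Operations on STPP families in arbitrary groups (CKSU 2005 §5; BCCGNSU 2017, proof of Lemma 3.5) -/

section Operations

variable {G : Type u} [Group G] {ι : Type v}

/-- `x y = 1 ↔ y x = 1` packaged for six-fold products: conjugating the CKSU relation.
[folklore] -/
theorem six_prod_eq_one_rotate (a a' b b' c c' : G) :
    a * a'⁻¹ * b * b'⁻¹ * c * c'⁻¹ = 1 ↔ b * b'⁻¹ * c * c'⁻¹ * a * a'⁻¹ = 1 := by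
  constructor
  · intro h
    calc b * b'⁻¹ * c * c'⁻¹ * a * a'⁻¹
        = (a * a'⁻¹)⁻¹ * (a * a'⁻¹ * b * b'⁻¹ * c * c'⁻¹) * (a * a'⁻¹) := by group
      _ = 1 := by rw [h]; group
  · intro h
    calc a * a'⁻¹ * b * b'⁻¹ * c * c'⁻¹
        = (a * a'⁻¹) * (b * b'⁻¹ * c * c'⁻¹ * a * a'⁻¹) * (a * a'⁻¹)⁻¹ := by group
      _ = 1 := by rw [h]; group

/-- Cyclic rotation `(A, B, C) ↦ (B, C, A)` preserves the STPP in any group (conjugate the CKSU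
relation). [folklore] -/
theorem _root_.Literature.Combinatorics.Additive.SimultaneousTPP.rotate {A B C : ι → Finset G}
    (h : SimultaneousTPP A B C) : SimultaneousTPP B C A := by
  refine ⟨fun i => ?_, fun i j k b hb b' hb' c hc c' hc' a ha a' ha' h0 => ?_⟩
  · intro t ht t' ht' u hu u' hu' s hs s' hs' h0
    have h0' : s * s'⁻¹ * (t * t'⁻¹) * (u * u'⁻¹) = 1 := by
      have h1 : t * t'⁻¹ * u * u'⁻¹ * s * s'⁻¹ = 1 := by simpa only [mul_assoc] using h0
      have h2 := (six_prod_eq_one_rotate s s' t t' u u').2 h1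
      simpa only [mul_assoc] using h2
    obtain ⟨hs, ht, hu⟩ := h.1 i s hs s' hs' t ht t' ht' u hu u' hu' h0'
    exact ⟨ht, hu, hs⟩
  · have h1 := (six_prod_eq_one_rotate a a' b b' c c').2 h0
    obtain ⟨hki, hij⟩ := h.2 k i j a ha a' ha' b hb b' hb' c hc c' hc' h1
    exact ⟨hij, hij.symm.trans hki.symm⟩

/-- Products of STPP families (in `G × G₂`, indexed by `ι × ι₂`) are STPP families (CKSU 2005,
Lemma 5.4 / BCCGNSU 2017, proof of Lemma 3.5), in any group.
[cite: BlasiakChurchCohnGrochowNaslundSawinUmans2017, Lemma 3.5 (proof)] -/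
theorem _root_.Literature.Combinatorics.Additive.SimultaneousTPP.prod {G₂ : Type*} [Group G₂]
    {ι₂ : Type*} {A B C : ι → Finset G} {A₂ B₂ C₂ : ι₂ → Finset G₂} (h : SimultaneousTPP A B C)
    (h₂ : SimultaneousTPP A₂ B₂ C₂) :
    SimultaneousTPP (fun p : ι × ι₂ => A p.1 ×ˢ A₂ p.2) (fun p => B p.1 ×ˢ B₂ p.2)
      (fun p => C p.1 ×ˢ C₂ p.2) := by
  refine ⟨fun p => ?_, ?_⟩
  · intro s hs s' hs' t ht t' ht' u hu u' hu' h0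
    simp only [Finset.mem_product] at hs hs' ht ht' hu hu'
    rw [Prod.ext_iff] at h0
    simp only [Prod.fst_mul, Prod.fst_inv, Prod.snd_mul, Prod.snd_inv, Prod.fst_one,
      Prod.snd_one] at h0
    obtain ⟨h1, h2, h3⟩ := h.1 p.1 _ hs.1 _ hs'.1 _ ht.1 _ ht'.1 _ hu.1 _ hu'.1 h0.1
    obtain ⟨h1', h2', h3'⟩ := h₂.1 p.2 _ hs.2 _ hs'.2 _ ht.2 _ ht'.2 _ hu.2 _ hu'.2 h0.2
    exact ⟨Prod.ext h1 h1', Prod.ext h2 h2', Prod.ext h3 h3'⟩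
  · rintro ⟨i, i₂⟩ ⟨j, j₂⟩ ⟨k, k₂⟩ a ha a' ha' b hb b' hb' c hc c' hc' h0
    simp only [Finset.mem_product] at ha ha' hb hb' hc hc'
    rw [Prod.ext_iff] at h0
    simp only [Prod.fst_mul, Prod.fst_inv, Prod.snd_mul, Prod.snd_inv, Prod.fst_one,
      Prod.snd_one] at h0
    obtain ⟨hij, hjk⟩ := h.2 i j k _ ha.1 _ ha'.1 _ hb.1 _ hb'.1 _ hc.1 _ hc'.1 h0.1
    obtain ⟨hij₂, hjk₂⟩ := h₂.2 i₂ j₂ k₂ _ ha.2 _ ha'.2 _ hb.2 _ hb'.2 _ hc.2 _ hc'.2 h0.2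
    exact ⟨Prod.ext hij hij₂, Prod.ext hjk hjk₂⟩

/-- Powers of an STPP family (in `G^κ`, indexed by `ι^κ`, the sets being boxes) are STPP
families (CKSU 2005, Lemma 5.4; BCCGNSU 2017, proof of Lemma 3.5), in any group.
[cite: BlasiakChurchCohnGrochowNaslundSawinUmans2017, Lemma 3.5 (proof)] -/
theorem _root_.Literature.Combinatorics.Additive.SimultaneousTPP.pi {κ : Type*} [Fintype κ]
    [DecidableEq κ] {A B C : ι → Finset G} (h : SimultaneousTPP A B C) :
    SimultaneousTPP (G := κ → G)
      (fun I : κ → ι => Fintype.piFinset fun l => A (I l))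
      (fun I => Fintype.piFinset fun l => B (I l))
      (fun I => Fintype.piFinset fun l => C (I l)) := by
  refine ⟨fun I => ?_, ?_⟩
  · intro s hs s' hs' t ht t' ht' u hu u' hu' h0
    simp only [Fintype.mem_piFinset] at hs hs' ht ht' hu hu'
    have hl : ∀ l, s l = s' l ∧ t l = t' l ∧ u l = u' l := fun l =>
      h.1 (I l) _ (hs l) _ (hs' l) _ (ht l) _ (ht' l) _ (hu l) _ (hu' l)
        (by simpa using congr_fun h0 l)
    exact ⟨funext fun l => (hl l).1, funext fun l => (hl l).2.1, funext fun l => (hl l).2.2⟩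
  · intro I J K a ha a' ha' b hb b' hb' c hc c' hc' h0
    simp only [Fintype.mem_piFinset] at ha ha' hb hb' hc hc'
    have hl : ∀ l, I l = J l ∧ J l = K l := fun l =>
      h.2 (I l) (J l) (K l) _ (ha l) _ (ha' l) _ (hb l) _ (hb' l) _ (hc l) _ (hc' l)
        (by simpa using congr_fun h0 l)
    exact ⟨funext fun l => (hl l).1, funext fun l => (hl l).2⟩

/-- Sub-families (reindexing along an injection) of STPP families are STPP families. [folklore] -/
theorem _root_.Literature.Combinatorics.Additive.SimultaneousTPP.comp {ι' : Type*}
    {A B C : ι → Finset G} (h : SimultaneousTPP A B C) {e : ι' → ι}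
    (he : Function.Injective e) : SimultaneousTPP (A ∘ e) (B ∘ e) (C ∘ e) := by
  refine ⟨fun i => h.1 (e i), fun i j k a ha a' ha' b hb b' hb' c hc c' hc' h0 => ?_⟩
  obtain ⟨hij, hjk⟩ := h.2 (e i) (e j) (e k) a ha a' ha' b hb b' hb' c hc c' hc' h0
  exact ⟨he hij, he hjk⟩

/-- **Per-triple packing** in any finite group: for an STPP (indeed TPP) triple,
`(|A||B||C|)² ≤ |G|³`, from the three injections `(a,b) ↦ a⁻¹b`, `(b,c) ↦ b c⁻¹ …` given by
the triple product property (BCCGNSU 2017, §2: `|Sᵢ| = |Aᵢ||Bᵢ|`, etc.; an empty set makes both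
sides trivial). [cite: BlasiakChurchCohnGrochowNaslundSawinUmans2017, §2] -/
theorem _root_.Literature.Combinatorics.Additive.TripleProductProperty.card_mul_sq_le
    [Fintype G] [DecidableEq G] {A B C : Finset G} (h : TripleProductProperty A B C) :
    (A.card * B.card * C.card) ^ 2 ≤ Fintype.card G ^ 3 := by
  classical
  -- generic injectivity statement: `(x, y) ↦ x⁻¹ y` on `X × Y`
  have key : ∀ X Y : Finset G, (∀ x ∈ X, ∀ x' ∈ X, ∀ y ∈ Y, ∀ y' ∈ Y,
      x⁻¹ * y = x'⁻¹ * y' → x = x' ∧ y = y') → X.card * Y.card ≤ Fintype.card G := by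
    intro X Y hXY
    have hinj : Set.InjOn (fun p : G × G => p.1⁻¹ * p.2) ↑(X ×ˢ Y) := by
      rintro ⟨x, y⟩ hp ⟨x', y'⟩ hp' (he : x⁻¹ * y = x'⁻¹ * y')
      simp only [Finset.coe_product, Set.mem_prod, Finset.mem_coe] at hp hp'
      obtain ⟨h1, h2⟩ := hXY x hp.1 x' hp'.1 y hp.2 y' hp'.2 he
      rw [h1, h2]
    calc X.card * Y.card = (X ×ˢ Y).card := (Finset.card_product _ _).symm
      _ = ((X ×ˢ Y).image fun p : G × G => p.1⁻¹ * p.2).card :=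
          (Finset.card_image_of_injOn hinj).symm
      _ ≤ Fintype.card G := Finset.card_le_univ _
  rcases C.eq_empty_or_nonempty with hC | ⟨c, hc⟩
  · simp [hC]
  rcases A.eq_empty_or_nonempty with hA | ⟨a, ha⟩
  · simp [hA]
  rcases B.eq_empty_or_nonempty with hB | ⟨b, hb⟩
  · simp [hB]
  have hAB : A.card * B.card ≤ Fintype.card G := key A B fun x hx x' hx' y hy y' hy' he => by
    have h0 : x' * x⁻¹ * (y * y'⁻¹) * (c * c⁻¹) = 1 := by
      calc _ = x' * (x⁻¹ * y) * y'⁻¹ := by group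
        _ = 1 := by rw [he]; group
    obtain ⟨h1, h2, -⟩ := h x' hx' x hx y hy y' hy' c hc c hc h0
    exact ⟨h1.symm, h2⟩
  have hBC : B.card * C.card ≤ Fintype.card G := key B C fun x hx x' hx' y hy y' hy' he => by
    have h0 : a * a⁻¹ * (x' * x⁻¹) * (y * y'⁻¹) = 1 := by
      calc _ = x' * (x⁻¹ * y) * y'⁻¹ := by group
        _ = 1 := by rw [he]; group
    obtain ⟨-, h1, h2⟩ := h a ha a ha x' hx' x hx y hy y' hy' h0
    exact ⟨h1.symm, h2⟩
  have hCA : A.card * C.card ≤ Fintype.card G := key A C fun x hx x' hx' y hy y' hy' he => by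
    -- `x'⁻¹ y' = x⁻¹ y` gives `x' x⁻¹ (b b⁻¹) (y y'⁻¹) = 1`
    have h0 : x' * x⁻¹ * (b * b⁻¹) * (y * y'⁻¹) = 1 := by
      calc _ = x' * (x⁻¹ * y) * y'⁻¹ := by group
        _ = 1 := by rw [he]; group
    obtain ⟨h1, -, h2⟩ := h x' hx' x hx b hb b hb y hy y' hy' h0
    exact ⟨h1.symm, h2⟩
  calc (A.card * B.card * C.card) ^ 2 = (A.card * B.card) * (B.card * C.card) * (A.card * C.card) := by
        ring
    _ ≤ Fintype.card G * Fintype.card G * Fintype.card G := by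
        gcongr
    _ = Fintype.card G ^ 3 := by ring

end Operations

/-! ## Border multiplicative matchings (BCCGNSU 2017, Def. 3.2 and Lemma 3.4, multiplicative form) -/

section Border

variable {G : Type u} [Group G] {ι : Type v}

/-- **Border multiplicative matching** (the multiplicative form of BCCGNSU 2017, Def. 3.2, in the
functional form of the tree's `IsBorderTricoloredSumFree`): families `s t u : ι → G` with integer
weights `α β γ` such that (i) `s i · t i · u i = 1` and `α i + β i + γ i = 0` on the matching,
(ii) `s i · t j · u k = 1` forces `α i + β j + γ k ≥ 0`, and (iii) with equality only on the
matching. With all weights `0` this is a multiplicative matching (`IsMulMatching`, BCCGU Def. 2.1).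
[cite: BlasiakChurchCohnGrochowNaslundSawinUmans2017, Def. 3.2] -/
def IsBorderMulMatching (s t u : ι → G) (α β γ : ι → ℤ) : Prop :=
  (∀ i, s i * t i * u i = 1 ∧ α i + β i + γ i = 0) ∧
  (∀ i j k, s i * t j * u k = 1 → 0 ≤ α i + β j + γ k) ∧
  (∀ i j k, s i * t j * u k = 1 → α i + β j + γ k = 0 → i = j ∧ j = k)

/-- A border multiplicative matching with constant `α` and `β` is a multiplicative matching
(last paragraph of the proof of BCCGNSU 2017, Lemma 3.4).
[cite: BlasiakChurchCohnGrochowNaslundSawinUmans2017, Lemma 3.4 (proof)] -/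
theorem IsBorderMulMatching.isMulMatching_of_weights_eq {s t u : ι → G} {α β γ : ι → ℤ}
    (h : IsBorderMulMatching s t u α β γ) (a b : ℤ) (hα : ∀ i, α i = a) (hβ : ∀ i, β i = b) :
    IsMulMatching s t u := by
  intro i j k
  constructor
  · intro h0
    refine h.2.2 i j k h0 ?_
    have hk := (h.1 k).2
    rw [hα, hβ] at hk ⊢
    exact hk
  · rintro ⟨rfl, rfl⟩
    exact (h.1 i).1

/-- **Powers of a border multiplicative matching** (BCCGNSU 2017, proof of Lemma 3.4, first
paragraph): coordinatewise families on `ι^N` with summed weights, in `G^N`.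
[cite: BlasiakChurchCohnGrochowNaslundSawinUmans2017, Lemma 3.4 (proof)] -/
theorem IsBorderMulMatching.pi {s t u : ι → G} {α β γ : ι → ℤ}
    (h : IsBorderMulMatching s t u α β γ) (N : ℕ) :
    IsBorderMulMatching (ι := Fin N → ι) (G := Fin N → G)
      (fun I l => s (I l)) (fun I l => t (I l)) (fun I l => u (I l))
      (fun I => ∑ l, α (I l)) (fun I => ∑ l, β (I l)) (fun I => ∑ l, γ (I l)) := by
  refine ⟨fun I => ⟨funext fun l => (h.1 (I l)).1, ?_⟩, fun I J K h0 => ?_, fun I J K h0 hw => ?_⟩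
  · rw [← Finset.sum_add_distrib, ← Finset.sum_add_distrib]
    exact Finset.sum_eq_zero fun l _ => (h.1 (I l)).2
  · rw [← Finset.sum_add_distrib, ← Finset.sum_add_distrib]
    exact Finset.sum_nonneg fun l _ => h.2.1 _ _ _ (congr_fun h0 l)
  · rw [← Finset.sum_add_distrib, ← Finset.sum_add_distrib] at hw
    have hl := (Finset.sum_eq_zero_iff_of_nonneg fun l _ => h.2.1 _ _ _ (congr_fun h0 l)).1 hw
    constructor
    · exact funext fun l => (h.2.2 _ _ _ (congr_fun h0 l) (hl l (mem_univ _))).1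
    · exact funext fun l => (h.2.2 _ _ _ (congr_fun h0 l) (hl l (mem_univ _))).2

/-- **BCCGNSU 2017, Lemma 3.4, multiplicative form**: from a border multiplicative matching of
size `|ι|` whose weights `α, β` are bounded by `R`, a multiplicative matching in `G^N` indexed
by a sub-family `M ⊆ ι^N` with `|ι|^N ≤ (2NR+1)² |M|` (pigeon-hole on the summed weights).
[cite: BlasiakChurchCohnGrochowNaslundSawinUmans2017, Lemma 3.4] -/
theorem IsBorderMulMatching.exists_isMulMatching_pi [Fintype ι] {s t u : ι → G} {α β γ : ι → ℤ}
    (h : IsBorderMulMatching s t u α β γ) (R : ℕ) (hR : ∀ i, |α i| ≤ R ∧ |β i| ≤ R) (N : ℕ) :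
    ∃ M : Finset (Fin N → ι),
      IsMulMatching (G := Fin N → G) (fun I : M => fun l => s (I.1 l))
        (fun I : M => fun l => t (I.1 l)) (fun I : M => fun l => u (I.1 l)) ∧
      Fintype.card ι ^ N ≤ (2 * N * R + 1) ^ 2 * M.card := by
  classical
  have hpi := h.pi N
  set wA : (Fin N → ι) → ℤ := fun I => ∑ l, α (I l) with hwA
  set wB : (Fin N → ι) → ℤ := fun I => ∑ l, β (I l) with hwB
  set f : (Fin N → ι) → ℤ × ℤ := fun I => (wA I, wB I) with hf
  set T : Finset (ℤ × ℤ) :=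
    (Finset.Icc (-(N * R : ℤ)) (N * R)) ×ˢ (Finset.Icc (-(N * R : ℤ)) (N * R)) with hT
  have hmaps : ∀ I ∈ (univ : Finset (Fin N → ι)), f I ∈ T := by
    intro I _
    have hb : ∀ (w : ι → ℤ), (∀ i, |w i| ≤ R) → |∑ l, w (I l)| ≤ N * R := by
      intro w hw
      calc |∑ l, w (I l)| ≤ ∑ l, |w (I l)| := Finset.abs_sum_le_sum_abs _ _
        _ ≤ ∑ _l : Fin N, (R : ℤ) := Finset.sum_le_sum fun l _ => hw (I l)
        _ = N * R := by simp
    have hA := hb α fun i => (hR i).1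
    have hB := hb β fun i => (hR i).2
    simp only [hT, hf, Finset.mem_product, Finset.mem_Icc]
    exact ⟨abs_le.1 hA, abs_le.1 hB⟩
  have hTcard : T.card = (2 * N * R + 1) ^ 2 := by
    have h1 : (Finset.Icc (-(N * R : ℤ)) (N * R)).card = 2 * N * R + 1 := by
      rw [Int.card_Icc]
      have : (N * R : ℤ) + 1 - -(N * R : ℤ) = ((2 * N * R + 1 : ℕ) : ℤ) := by push_cast; ring
      rw [this, Int.toNat_natCast]
    rw [hT, Finset.card_product, h1, sq]
  have hTne : T.Nonempty := by
    have h0 : (0 : ℤ) ≤ N * R := by positivity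
    refine ⟨(0, 0), ?_⟩
    simp only [hT, Finset.mem_product, Finset.mem_Icc]
    exact ⟨⟨by linarith, h0⟩, by linarith, h0⟩
  obtain ⟨y, hyT, hmax⟩ := T.exists_max_image (fun y => (univ.filter fun I => f I = y).card) hTne
  set M : Finset (Fin N → ι) := univ.filter fun I => f I = y with hM
  refine ⟨M, ?_, ?_⟩
  · refine IsBorderMulMatching.isMulMatching_of_weights_eq (α := fun I : M => wA I.1)
      (β := fun I : M => wB I.1) (γ := fun I : M => ∑ l, γ (I.1 l)) ?_ y.1 y.2 ?_ ?_
    · refine ⟨fun I => hpi.1 I.1, fun I J K h0 => hpi.2.1 I.1 J.1 K.1 h0, fun I J K h0 hw => ?_⟩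
      have := hpi.2.2 I.1 J.1 K.1 h0 hw
      exact ⟨Subtype.ext this.1, Subtype.ext this.2⟩
    · intro I
      have hI := (mem_filter.1 I.2).2
      simp only [hf, Prod.ext_iff] at hI
      exact hI.1
    · intro I
      have hI := (mem_filter.1 I.2).2
      simp only [hf, Prod.ext_iff] at hI
      exact hI.2
  · have hsum := Finset.card_eq_sum_card_fiberwise hmaps
    rw [card_univ, Fintype.card_pi, Finset.prod_const, card_univ, Fintype.card_fin] at hsum
    rw [hsum, ← hTcard]
    calc ∑ b ∈ T, (univ.filter fun I : Fin N → ι => f I = b).card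
        ≤ ∑ _b ∈ T, M.card := Finset.sum_le_sum fun b hb => hmax b hb
      _ = T.card * M.card := by rw [Finset.sum_const, smul_eq_mul]

end Border

/-! ## Theorem 3.3, multiplicative form: STPP constructions yield border multiplicative matchings -/

section STPP

variable {G : Type u} [Group G] [DecidableEq G] {ι₀ : Type v} [Fintype ι₀]

/-- **BCCGNSU 2017, Thm. 3.3 in an arbitrary finite group** (the input of BCCGU 2017, Thm. 2.9:
"Any family of STPP constructions … that meets the packing bound implies the existence of
multiplicative matchings in `G^N`"): an STPP construction `(Aᵢ, Bᵢ, Cᵢ)` (CKSU Def. 5.1, the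
tree's `SimultaneousTPP`) yields a border multiplicative matching of size
`≥ Σᵢ |Aᵢ||Bᵢ||Cᵢ| / (|Aᵢ| + |Bᵢ| + |Cᵢ|)`. Construction as printed, made multiplicative:
`Mᵢ = {(a,b,c) ∈ Aᵢ × Bᵢ × Cᵢ : rank a + rank b + rank c = rᵢ}` for a most popular `rᵢ`, the three
families are `c⁻¹a`, `a⁻¹b`, `b⁻¹c` (so that `(c⁻¹a)(a'⁻¹b)(b'⁻¹c') = 1` is, after conjugation,
the CKSU relation `a a'⁻¹ b b'⁻¹ c' c⁻¹ = 1`), and the weights complete the square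
`(ρ(a)+ρ(b)+ρ(c)-rᵢ)²`. [cite: BlasiakChurchCohnGrochowNaslundSawinUmans2017, Thm. 3.3]
[cite: BlasiakChurchCohnGrochowUmans2017, Thm. 2.9] -/
theorem _root_.Literature.Combinatorics.Additive.SimultaneousTPP.exists_isBorderMulMatching
    {A B C : ι₀ → Finset G} (hS : SimultaneousTPP A B C) :
    ∃ (M : Finset (Σ _ : ι₀, G × G × G)) (α β γ : (Σ _ : ι₀, G × G × G) → ℤ),
      IsBorderMulMatching
        (fun x : M => (x.1.2.2.2)⁻¹ * x.1.2.1) (fun x : M => (x.1.2.1)⁻¹ * x.1.2.2.1)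
        (fun x : M => (x.1.2.2.1)⁻¹ * x.1.2.2.2) (fun x : M => α x.1) (fun x : M => β x.1)
        (fun x : M => γ x.1) ∧
      ∑ i, ((A i).card * (B i).card * (C i).card : ℝ) / ((A i).card + (B i).card + (C i).card)
        ≤ M.card := by
  classical
  choose r hr using fun i => exists_popular_rankSum (A i) (B i) (C i)
  set ρA : ι₀ → G → ℤ := fun i a => (finsetRank (A i) a : ℤ) with hρA
  set ρB : ι₀ → G → ℤ := fun i b => (finsetRank (B i) b : ℤ) with hρB
  set ρC : ι₀ → G → ℤ := fun i c => (finsetRank (C i) c : ℤ) with hρC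
  set Mi : ∀ i : ι₀, Finset (G × G × G) := fun i => ((A i) ×ˢ (B i) ×ˢ (C i)).filter fun x =>
    finsetRank (A i) x.1 + finsetRank (B i) x.2.1 + finsetRank (C i) x.2.2 = r i with hMi
  set M : Finset (Σ _ : ι₀, G × G × G) := univ.sigma Mi with hM
  set α : (Σ _ : ι₀, G × G × G) → ℤ := fun x =>
    ρA x.1 x.2.1 ^ 2 + 2 * ρC x.1 x.2.2.2 * ρA x.1 x.2.1 - 2 * ρA x.1 x.2.1 * r x.1 +
      (r x.1 : ℤ) ^ 2 with hα
  set β : (Σ _ : ι₀, G × G × G) → ℤ := fun x =>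
    ρB x.1 x.2.2.1 ^ 2 + 2 * ρA x.1 x.2.1 * ρB x.1 x.2.2.1 - 2 * ρB x.1 x.2.2.1 * r x.1 with hβ
  set γ : (Σ _ : ι₀, G × G × G) → ℤ := fun x =>
    ρC x.1 x.2.2.2 ^ 2 + 2 * ρB x.1 x.2.2.1 * ρC x.1 x.2.2.2 - 2 * ρC x.1 x.2.2.2 * r x.1 with hγ
  -- membership in `M`
  have hmem : ∀ x : M, x.1.2.1 ∈ A x.1.1 ∧ x.1.2.2.1 ∈ B x.1.1 ∧ x.1.2.2.2 ∈ C x.1.1 ∧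
      ρA x.1.1 x.1.2.1 + ρB x.1.1 x.1.2.2.1 + ρC x.1.1 x.1.2.2.2 = r x.1.1 := by
    rintro ⟨⟨i, a, b, c⟩, hx⟩
    simp only [hM, hMi, Finset.mem_sigma, Finset.mem_univ, true_and, Finset.mem_filter,
      Finset.mem_product] at hx
    refine ⟨hx.1.1, hx.1.2.1, hx.1.2.2, ?_⟩
    simp only [hρA, hρB, hρC]
    exact_mod_cast hx.2
  have key0 : ∀ a b c : G, c⁻¹ * a * (a⁻¹ * b) * (b⁻¹ * c) = 1 := fun a b c => by group
  -- from `(c⁻¹ a)(a'⁻¹ b')(b''⁻¹ c'') = 1` to the CKSU relation and its TPP bracketing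
  have key1 : ∀ a c a' b' b'' c'' : G, c⁻¹ * a * (a'⁻¹ * b') * (b''⁻¹ * c'') = 1 →
      a * a'⁻¹ * b' * b''⁻¹ * c'' * c⁻¹ = 1 := by
    intro a c a' b' b'' c'' h
    calc a * a'⁻¹ * b' * b''⁻¹ * c'' * c⁻¹
        = c * (c⁻¹ * a * (a'⁻¹ * b') * (b''⁻¹ * c'')) * c⁻¹ := by group
      _ = 1 := by rw [h]; group
  have hSTPP : ∀ x y z : M,
      (x.1.2.2.2)⁻¹ * x.1.2.1 * ((y.1.2.1)⁻¹ * y.1.2.2.1) * ((z.1.2.2.1)⁻¹ * z.1.2.2.2) = 1 →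
      x.1.1 = y.1.1 ∧ y.1.1 = z.1.1 ∧ x.1.2.1 = y.1.2.1 ∧ y.1.2.2.1 = z.1.2.2.1 ∧
        z.1.2.2.2 = x.1.2.2.2 := by
    intro x y z h0
    obtain ⟨ha, hb, hc, -⟩ := hmem x
    obtain ⟨ha', hb', hc', -⟩ := hmem y
    obtain ⟨ha'', hb'', hc'', -⟩ := hmem z
    have h1 := key1 _ _ _ _ _ _ h0
    obtain ⟨hij, hjk⟩ := hS.2 x.1.1 y.1.1 z.1.1 _ ha _ ha' _ hb' _ hb'' _ hc'' _ hc h1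
    have h2 : x.1.2.1 * (y.1.2.1)⁻¹ * (y.1.2.2.1 * (z.1.2.2.1)⁻¹) * (z.1.2.2.2 * (x.1.2.2.2)⁻¹) = 1 := by
      simpa only [mul_assoc] using h1
    have hi := hS.1 x.1.1
    rw [hij] at ha hi
    rw [← hjk] at hb'' hc''
    obtain ⟨haa, hbb, hcc⟩ := hi _ ha _ ha' _ hb' _ hb'' _ hc'' _ (hij ▸ hc) h2
    exact ⟨hij, hjk, haa, hbb, hcc⟩
  refine ⟨M, α, β, γ, ⟨fun x => ⟨key0 _ _ _, ?_⟩, fun x y z h0 => ?_, fun x y z h0 hw => ?_⟩, ?_⟩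
  · -- weights vanish on the matching
    obtain ⟨-, -, -, hsum⟩ := hmem x
    have : α x.1 + β x.1 + γ x.1 =
        (ρA x.1.1 x.1.2.1 + ρB x.1.1 x.1.2.2.1 + ρC x.1.1 x.1.2.2.2 - r x.1.1) ^ 2 := by
      simp only [hα, hβ, hγ]; ring
    rw [this, hsum, sub_self, zero_pow two_ne_zero]
  · -- nonnegativity
    obtain ⟨hij, hjk, haa, hbb, hcc⟩ := hSTPP x y z h0
    have : α x.1 + β y.1 + γ z.1 =
        (ρA x.1.1 x.1.2.1 + ρB y.1.1 y.1.2.2.1 + ρC x.1.1 x.1.2.2.2 - r x.1.1) ^ 2 := by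
      simp only [hα, hβ, hγ]
      rw [← hjk, ← hij, haa, ← hbb, hcc]
      ring
    rw [this]
    exact sq_nonneg _
  · -- vanishing forces the matching
    obtain ⟨ha, hb, hc, hx⟩ := hmem x
    obtain ⟨ha', hb', hc', hy⟩ := hmem y
    obtain ⟨ha'', hb'', hc'', hz⟩ := hmem z
    obtain ⟨hij, hjk, haa, hbb, hcc⟩ := hSTPP x y z h0
    have hsq : α x.1 + β y.1 + γ z.1 =
        (ρA x.1.1 x.1.2.1 + ρB y.1.1 y.1.2.2.1 + ρC x.1.1 x.1.2.2.2 - r x.1.1) ^ 2 := by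
      simp only [hα, hβ, hγ]
      rw [← hjk, ← hij, haa, ← hbb, hcc]
      ring
    rw [hsq] at hw
    have hw' : ρA x.1.1 x.1.2.1 + ρB y.1.1 y.1.2.2.1 + ρC x.1.1 x.1.2.2.2 = r x.1.1 := by
      have := pow_eq_zero_iff (n := 2) two_ne_zero |>.1 hw
      linarith
    obtain ⟨⟨i, a, b, c⟩, hxM⟩ := x
    obtain ⟨⟨j, a', b', c'⟩, hyM⟩ := y
    obtain ⟨⟨k, a'', b'', c''⟩, hzM⟩ := z
    simp only at hij hjk haa hbb hcc hx hy hz hw' ha hb hc ha' hb' hc' ha'' hb'' hc'' ⊢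
    subst hij hjk
    -- `b = b'` from `x`'s equation, `c' = c` from `y`'s, `a'' = a` from `z`'s
    have hb1 : b = b' := by
      refine finsetRank_injOn hb hb' ?_
      have : ρB i b = ρB i b' := by linarith
      simpa [hρB] using this
    have hc1 : c' = c := by
      refine finsetRank_injOn hc' hc ?_
      rw [← haa] at hy
      have : ρC i c' = ρC i c := by linarith
      simpa [hρC] using this
    have ha1 : a'' = a := by
      refine finsetRank_injOn ha'' ha ?_
      rw [← hbb, hcc] at hz
      have : ρA i a'' = ρA i a := by linarith
      simpa [hρA] using this
    refine ⟨Subtype.ext ?_, Subtype.ext ?_⟩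
    · simp only [Sigma.mk.injEq, heq_eq_eq, Prod.mk.injEq, true_and]
      exact ⟨haa, hb1, hc1.symm⟩
    · simp only [Sigma.mk.injEq, heq_eq_eq, Prod.mk.injEq, true_and]
      exact ⟨haa.symm.trans ha1.symm, hbb, hc1.trans hcc.symm⟩
  · -- size
    rw [hM, Finset.card_sigma, Nat.cast_sum]
    refine Finset.sum_le_sum fun i _ => ?_
    have h := hr i
    rcases Nat.eq_zero_or_pos ((A i).card + (B i).card + (C i).card) with h0 | hpos
    · have hA : (A i).card = 0 := by omega
      simp [hA]
    · rw [div_le_iff₀ (by exact_mod_cast hpos)]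
      calc ((A i).card * (B i).card * (C i).card : ℝ)
          ≤ (((A i).card + (B i).card + (C i).card) * (Mi i).card : ℕ) := by exact_mod_cast h
        _ = ((Mi i).card : ℝ) * ((A i).card + (B i).card + (C i).card) := by push_cast; ring

end STPP



/-! ## Matchings: transport and trivial groups -/

section MatchingAPI

variable {G : Type u} [Group G] {ι : Type v}

/-- Multiplicative matchings are transported along injective homomorphisms. [folklore] -/
theorem IsMulMatching.map {G' : Type*} [Group G'] {s t u : ι → G} (h : IsMulMatching s t u)
    (f : G →* G') (hf : Function.Injective f) :
    IsMulMatching (f ∘ s) (f ∘ t) (f ∘ u) := by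
  intro i j k
  rw [← h i j k]
  simp only [Function.comp_apply, ← map_mul]
  constructor
  · intro h1
    exact hf (by rw [h1, map_one])
  · intro h1
    rw [h1, map_one]

/-- In a trivial group a multiplicative matching has at most one element. [folklore] -/
theorem IsMulMatching.card_le_one [Subsingleton G] [Fintype ι] {s t u : ι → G}
    (h : IsMulMatching s t u) : Fintype.card ι ≤ 1 := by
  refine Fintype.card_le_one_iff_subsingleton.2 ⟨fun i j => ?_⟩
  exact ((h i j j).1 (Subsingleton.elim _ _)).1

end MatchingAPI

/-! ## Uniform square STPP families: the §3.2 estimate (multiplicative) -/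

section Uniform

/-- **The §3.2 estimate of BCCGNSU 2017, multiplicative and effective** (the engine of BCCGU
2017, Thm. 2.9): let `G` be a finite group such that every multiplicative matching in `G^{N'}`
has size at most `C · K^{N'}` (all `N'`). If an STPP family in `G` indexed by `ι` is *uniform and
square*, `|Aᵢ| = |Bᵢ| = |Cᵢ| = m` for all `i`, then `|ι| m² ≤ 3K`: Thm. 3.3 (multiplicative,
`SimultaneousTPP.exists_isBorderMulMatching`) gives a border matching of size `≥ |ι| m²/3`,
Lemma 3.4 (`IsBorderMulMatching.exists_isMulMatching_pi`) converts its `N'`-th power into a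
matching in `G^{N'}` of size `≥ (|ι|m²/3)^{N'}/(2N't+1)²`, and `N' → ∞`.
[cite: BlasiakChurchCohnGrochowNaslundSawinUmans2017, §3.2]
[cite: BlasiakChurchCohnGrochowUmans2017, Thm. 2.9] -/
theorem _root_.Literature.Combinatorics.Additive.SimultaneousTPP.card_mul_sq_le {G : Type}
    [Group G] [DecidableEq G] {C K : ℝ} (hK : 0 < K)
    (hMM : ∀ (N' : ℕ) (ι' : Type) [Fintype ι'] (s t u : ι' → (Fin N' → G)),
      IsMulMatching s t u → (Fintype.card ι' : ℝ) ≤ C * K ^ N')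
    {ι : Type} [Fintype ι] {A B C' : ι → Finset G} (hS : SimultaneousTPP A B C') {m : ℕ}
    (hA : ∀ i, (A i).card = m) (hB : ∀ i, (B i).card = m) (hC' : ∀ i, (C' i).card = m) :
    (Fintype.card ι : ℝ) * (m : ℝ) ^ 2 ≤ 3 * K := by
  classical
  rcases Nat.eq_zero_or_pos m with hm | hm
  · subst hm; simp; positivity
  obtain ⟨M, α, β, γ, hBd, hsize⟩ := hS.exists_isBorderMulMatching
  have hMsize : (Fintype.card ι : ℝ) * (m : ℝ) ^ 2 / 3 ≤ M.card := by
    refine le_trans (le_of_eq ?_) hsize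
    simp only [hA, hB, hC']
    rw [Finset.sum_const, card_univ, nsmul_eq_mul]
    have hm0 : (m : ℝ) ≠ 0 := by exact_mod_cast hm.ne'
    field_simp
    ring
  set R : ℕ := Finset.univ.sup fun x : M => max (α x.1).natAbs (β x.1).natAbs with hR
  have hRb : ∀ x : M, |α x.1| ≤ R ∧ |β x.1| ≤ R := by
    intro x
    have hx : max (α x.1).natAbs (β x.1).natAbs ≤ R := Finset.le_sup (f := fun x : M =>
      max (α x.1).natAbs (β x.1).natAbs) (mem_univ x)
    rw [Int.abs_eq_natAbs, Int.abs_eq_natAbs]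
    constructor <;> [exact_mod_cast (le_max_left _ _).trans hx;
      exact_mod_cast (le_max_right _ _).trans hx]
  have hpow : ∀ N' : ℕ, 1 ≤ N' →
      ((M.card : ℕ) : ℝ) ^ N' ≤ C * (2 * R + 1) ^ 2 * ((N' : ℝ) + 1) ^ 2 * K ^ N' := by
    intro N' hN'
    obtain ⟨M', hT, hcard⟩ := hBd.exists_isMulMatching_pi R hRb N'
    have h1 := hMM N' M' _ _ _ hT
    rw [Fintype.card_coe] at h1
    have h2 : ((Fintype.card M : ℕ) : ℝ) ^ N' ≤ ((2 * N' * R + 1) ^ 2 : ℕ) * (M'.card : ℝ) := by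
      exact_mod_cast hcard
    rw [Fintype.card_coe] at h2
    have hC0 : 0 ≤ C := by
      have := h1.trans' (Nat.cast_nonneg _)
      exact nonneg_of_mul_nonneg_left this (pow_pos hK _)
    have h3 : (((2 * N' * R + 1) ^ 2 : ℕ) : ℝ) ≤ (2 * R + 1) ^ 2 * ((N' : ℝ) + 1) ^ 2 := by
      rw [← mul_pow]
      push_cast
      apply pow_le_pow_left₀ (by positivity)
      nlinarith [show (0 : ℝ) ≤ R from by positivity, show (1 : ℝ) ≤ N' from by exact_mod_cast hN']
    calc ((M.card : ℕ) : ℝ) ^ N' ≤ ((2 * N' * R + 1) ^ 2 : ℕ) * (M'.card : ℝ) := h2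
      _ ≤ ((2 * R + 1) ^ 2 * ((N' : ℝ) + 1) ^ 2) * (C * K ^ N') := by gcongr
      _ = C * (2 * R + 1) ^ 2 * ((N' : ℝ) + 1) ^ 2 * K ^ N' := by ring
  have hMK : (M.card : ℝ) ≤ K :=
    le_of_pow_le_poly_mul_pow (c := C * (2 * R + 1) ^ 2) (d := 2) hK fun N' hN' => by
      have := hpow N' hN'
      linarith
  linarith

end Uniform

/-! ## The tensor-power / type argument (BCCGNSU 2017, Lemma 3.5 and §3.2, multiplicative) -/

section TypeArgument

/-- **Per-type estimate**, multiplicative (BCCGNSU 2017, Lemma 3.5 + §3.2, effective): for the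
product STPP family `(A^u × B^v × C^w, B^u × C^v × A^w, C^u × A^v × B^w)` in `(H^N)^3`
restricted to words `u, v, w` of a fixed type `τ` (uniform and square with `T_τ³` triples of size
`m_τ = ∏ᵢ (|Aᵢ||Bᵢ||Cᵢ|)^{τᵢ}`), `SimultaneousTPP.card_mul_sq_le` gives `T_τ³ m_τ² ≤ 3K`.
[cite: BlasiakChurchCohnGrochowNaslundSawinUmans2017, Lemma 3.5] -/
theorem _root_.Literature.Combinatorics.Additive.SimultaneousTPP.card_fiber_pow_three_mul_sq_le
    {H : Type} [Group H] [DecidableEq H] {ι₀ : Type} [Fintype ι₀] [DecidableEq ι₀]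
    {A B C : ι₀ → Finset H} (hS : SimultaneousTPP A B C) (N : ℕ) {K : ℝ} (hK : 0 < K)
    (hMM : ∀ (N' : ℕ) (ι' : Type) [Fintype ι']
      (s t u : ι' → (Fin N' → (Fin N → H) × (Fin N → H) × (Fin N → H))),
      IsMulMatching s t u → (Fintype.card ι' : ℝ) ≤ 3 * K ^ N')
    (τ : ι₀ → Fin (N + 1)) :
    (((univ : Finset (Fin N → ι₀)).filter fun u => wordType u = τ).card : ℝ) ^ 3 *
      (((∏ i, ((A i).card * (B i).card * (C i).card) ^ (τ i : ℕ) : ℕ) : ℝ)) ^ 2 ≤ 3 * K := by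
  classical
  set Tf : Finset (Fin N → ι₀) := univ.filter fun u => wordType u = τ with hTf
  have hTfmem : ∀ u : Tf, wordType u.1 = τ := fun u => (mem_filter.1 u.2).2
  set piA : (Fin N → ι₀) → Finset (Fin N → H) := fun u => Fintype.piFinset fun l => A (u l)
    with hpiA
  set piB : (Fin N → ι₀) → Finset (Fin N → H) := fun u => Fintype.piFinset fun l => B (u l)
    with hpiB
  set piC : (Fin N → ι₀) → Finset (Fin N → H) := fun u => Fintype.piFinset fun l => C (u l)
    with hpiC
  have hSpi : SimultaneousTPP (G := Fin N → H) piA piB piC := hS.pi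
  have hbig := hSpi.prod (hSpi.rotate.prod hSpi.rotate.rotate)
  set emb : Tf × Tf × Tf → (Fin N → ι₀) × (Fin N → ι₀) × (Fin N → ι₀) :=
    fun x => (x.1.1, x.2.1.1, x.2.2.1) with hemb
  have hinj : Function.Injective emb := by
    rintro ⟨u, v, w⟩ ⟨u', v', w'⟩ h
    simp only [hemb, Prod.mk.injEq] at h
    exact Prod.ext (Subtype.ext h.1) (Prod.ext (Subtype.ext h.2.1) (Subtype.ext h.2.2))
  have hSτ := hbig.comp hinj
  have hsA : ∀ u : Tf, (piA u.1).card = ∏ i, (A i).card ^ (τ i : ℕ) := by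
    intro u; rw [hpiA]; simp only
    rw [Fintype.card_piFinset, prod_eq_prod_pow_wordType (fun i => (A i).card) u.1, hTfmem u]
  have hsB : ∀ u : Tf, (piB u.1).card = ∏ i, (B i).card ^ (τ i : ℕ) := by
    intro u; rw [hpiB]; simp only
    rw [Fintype.card_piFinset, prod_eq_prod_pow_wordType (fun i => (B i).card) u.1, hTfmem u]
  have hsC : ∀ u : Tf, (piC u.1).card = ∏ i, (C i).card ^ (τ i : ℕ) := by
    intro u; rw [hpiC]; simp only
    rw [Fintype.card_piFinset, prod_eq_prod_pow_wordType (fun i => (C i).card) u.1, hTfmem u]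
  set mτ : ℕ := (∏ i, (A i).card ^ (τ i : ℕ)) * (∏ i, (B i).card ^ (τ i : ℕ)) *
    (∏ i, (C i).card ^ (τ i : ℕ)) with hmτ
  have hmτ' : mτ = ∏ i, ((A i).card * (B i).card * (C i).card) ^ (τ i : ℕ) := by
    rw [hmτ, ← Finset.prod_mul_distrib, ← Finset.prod_mul_distrib]
    refine Finset.prod_congr rfl fun i _ => ?_
    rw [mul_pow, mul_pow]
  have hU := SimultaneousTPP.card_mul_sq_le (C := 3) hK hMM hSτ (m := mτ)
    (fun x => by
      show (piA x.1.1 ×ˢ (piB x.2.1.1 ×ˢ piC x.2.2.1)).card = mτ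
      rw [Finset.card_product, Finset.card_product, hsA, hsB, hsC, hmτ, mul_assoc])
    (fun x => by
      show (piB x.1.1 ×ˢ (piC x.2.1.1 ×ˢ piA x.2.2.1)).card = mτ
      rw [Finset.card_product, Finset.card_product, hsA, hsB, hsC, hmτ]; ring)
    (fun x => by
      show (piC x.1.1 ×ˢ (piA x.2.1.1 ×ˢ piB x.2.2.1)).card = mτ
      rw [Finset.card_product, Finset.card_product, hsA, hsB, hsC, hmτ]; ring)
  rw [Fintype.card_prod, Fintype.card_prod, Fintype.card_coe, hmτ'] at hU
  push_cast at hU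
  refine le_trans (le_of_eq ?_) hU
  push_cast
  ring

/-- **BCCGU 2017, Thm. 2.9 with Thm. 2.8, effective multiplicative form of BCCGNSU §3.2**: let
`H` be a finite group and `Y > 0` such that for all `N, N'` every multiplicative matching in
`((H^N)^3)^{N'}` has size `≤ 3 (Y^{3N})^{N'}` (e.g. `Y = |H|^{1-δ}` when the powers of `H` have
slice rank `≤ |H|^{M(1-δ)}`). Then every STPP family in `H` satisfies
`Σᵢ (|Aᵢ||Bᵢ||Cᵢ|)^{2/3} ≤ Y`. Proof: expand `F^N = Σ_{u ∈ ι₀^N} ∏ₗ m_{u_l}^{2/3}`, group words by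
type (at most `(N+1)^{|ι₀|}` types), bound each type by `card_fiber_pow_three_mul_sq_le`, and
let `N → ∞`. [cite: BlasiakChurchCohnGrochowUmans2017, Thm. 2.9]
[cite: BlasiakChurchCohnGrochowNaslundSawinUmans2017, §3.2] -/
theorem _root_.Literature.Combinatorics.Additive.SimultaneousTPP.sum_rpow_le_of_matching_bound
    {H : Type} [Group H] [DecidableEq H] {Y : ℝ} (hY : 0 < Y)
    (hMM : ∀ (N N' : ℕ) (ι' : Type) [Fintype ι']
      (s t u : ι' → (Fin N' → (Fin N → H) × (Fin N → H) × (Fin N → H))),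
      IsMulMatching s t u → (Fintype.card ι' : ℝ) ≤ 3 * (Y ^ (3 * N)) ^ N')
    {ι₀ : Type} [Fintype ι₀] [DecidableEq ι₀] {A B C : ι₀ → Finset H}
    (hS : SimultaneousTPP A B C) :
    ∑ i, (((A i).card * (B i).card * (C i).card : ℕ) : ℝ) ^ ((2 : ℝ) / 3) ≤ Y := by
  set m : ι₀ → ℕ := fun i => (A i).card * (B i).card * (C i).card with hm
  set F : ℝ := ∑ i, ((m i : ℕ) : ℝ) ^ ((2 : ℝ) / 3) with hF
  suffices hclaim : ∀ N : ℕ, 1 ≤ N →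
      F ^ N ≤ (3 : ℝ) ^ ((1 : ℝ) / 3) * ((N : ℝ) + 1) ^ Fintype.card ι₀ * Y ^ N from
    le_of_pow_le_poly_mul_pow hY hclaim
  intro N hN
  set K : ℝ := Y ^ (3 * N) with hK
  have hKpos : 0 < K := pow_pos hY _
  have htype_bound := fun τ => hS.card_fiber_pow_three_mul_sq_le N hKpos (hMM N) τ
  have hFN : F ^ N =
      ∑ u : Fin N → ι₀, (((∏ i, m i ^ (wordType u i : ℕ) : ℕ) : ℝ)) ^ ((2 : ℝ) / 3) := by
    have h1 : F ^ N = ∏ _l : Fin N, F := by rw [Finset.prod_const, card_univ, Fintype.card_fin]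
    rw [h1, hF, Fintype.prod_sum (fun (_ : Fin N) (i : ι₀) => ((m i : ℕ) : ℝ) ^ ((2 : ℝ) / 3))]
    refine Finset.sum_congr rfl fun u _ => ?_
    rw [Real.finsetProd_rpow _ _ (fun l _ => by positivity), ← prod_eq_prod_pow_wordType m u]
    push_cast
    rfl
  rw [hFN, ← Finset.sum_fiberwise_of_maps_to (g := wordType) (t := univ) (fun u _ => mem_univ _)]
  have h3 : (0 : ℝ) ≤ (3 : ℝ) ^ ((1 : ℝ) / 3) * Y ^ N :=
    mul_nonneg (Real.rpow_nonneg (by norm_num) _) (pow_nonneg hY.le _)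
  have hτ : ∀ τ : ι₀ → Fin (N + 1),
      ∑ u ∈ univ.filter (fun u => wordType u = τ),
        (((∏ i, m i ^ (wordType u i : ℕ) : ℕ) : ℝ)) ^ ((2 : ℝ) / 3) ≤
          3 ^ ((1 : ℝ) / 3) * Y ^ N := by
    intro τ
    rw [Finset.sum_congr rfl fun u hu => (show (((∏ i, m i ^ (wordType u i : ℕ) : ℕ) : ℝ)) ^
      ((2 : ℝ) / 3) = (((∏ i, m i ^ (τ i : ℕ) : ℕ) : ℝ)) ^ ((2 : ℝ) / 3) by
        rw [(mem_filter.1 hu).2]), Finset.sum_const, nsmul_eq_mul]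
    set T : ℝ := (((univ : Finset (Fin N → ι₀)).filter fun u => wordType u = τ).card : ℝ) with hT
    set P : ℝ := ((∏ i, m i ^ (τ i : ℕ) : ℕ) : ℝ) with hP
    have hP0 : 0 ≤ P := Nat.cast_nonneg _
    have hb : T ^ 3 * P ^ 2 ≤ 3 * K := htype_bound τ
    refine le_of_pow_le_pow_left₀ three_ne_zero h3 ?_
    calc (T * P ^ ((2 : ℝ) / 3)) ^ 3 = T ^ 3 * P ^ 2 := by
          rw [mul_pow, ← Real.rpow_natCast (P ^ ((2 : ℝ) / 3)) 3, ← Real.rpow_mul hP0]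
          norm_num
      _ ≤ 3 * K := hb
      _ = ((3 : ℝ) ^ ((1 : ℝ) / 3) * Y ^ N) ^ 3 := by
          rw [mul_pow, ← Real.rpow_natCast ((3 : ℝ) ^ ((1 : ℝ) / 3)) 3,
            ← Real.rpow_mul (by norm_num : (0 : ℝ) ≤ 3), hK, ← pow_mul, mul_comm N 3]
          norm_num
  calc ∑ τ : ι₀ → Fin (N + 1), ∑ u ∈ univ.filter (fun u => wordType u = τ),
        (((∏ i, m i ^ (wordType u i : ℕ) : ℕ) : ℝ)) ^ ((2 : ℝ) / 3)
      ≤ ∑ _τ : ι₀ → Fin (N + 1), (3 : ℝ) ^ ((1 : ℝ) / 3) * Y ^ N :=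
        Finset.sum_le_sum fun τ _ => hτ τ
    _ = (3 : ℝ) ^ ((1 : ℝ) / 3) * ((N : ℝ) + 1) ^ Fintype.card ι₀ * Y ^ N := by
        rw [Finset.sum_const, card_univ, nsmul_eq_mul, Fintype.card_fun, Fintype.card_fin]
        push_cast
        ring

end TypeArgument

/-! ## Powers of `G`: from slice rank of `D_{G^M}` to matchings in `((G^N)^3)^{N'}` -/

section Powers

variable {G : Type u} [Group G]

/-- The coordinate embedding `((G^N)^3)^{N'} →* G^{N' × (N ⊔ N ⊔ N)}`. [folklore] -/
def piProdThreeHom (N N' : ℕ) :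
    (Fin N' → (Fin N → G) × (Fin N → G) × (Fin N → G)) →*
      (Fin N' × ((Fin N ⊕ Fin N) ⊕ Fin N) → G) where
  toFun f p := Sum.elim (Sum.elim (f p.1).1 (f p.1).2.1) (f p.1).2.2 p.2
  map_one' := by
    funext ⟨l, w⟩
    rcases w with ((c | c) | c) <;> rfl
  map_mul' f g := by
    funext ⟨l, w⟩
    rcases w with ((c | c) | c) <;> rfl

/-- The coordinate embedding is injective. [folklore] -/
theorem piProdThreeHom_injective (N N' : ℕ) :
    Function.Injective (piProdThreeHom (G := G) N N') := by
  intro f g h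
  funext l
  have h1 : ∀ w, piProdThreeHom N N' f (l, w) = piProdThreeHom N N' g (l, w) := fun w => by rw [h]
  refine Prod.ext ?_ (Prod.ext ?_ ?_)
  · funext c; exact h1 (Sum.inl (Sum.inl c))
  · funext c; exact h1 (Sum.inl (Sum.inr c))
  · funext c; exact h1 (Sum.inr c)

/-- Reindexing `G^T →* G^{Fin |T|}` along `Fintype.equivFin`. [folklore] -/
def piReindexHom (T : Type*) [Fintype T] : (T → G) →* (Fin (Fintype.card T) → G) where
  toFun x m := x ((Fintype.equivFin T).symm m)
  map_one' := rfl
  map_mul' _ _ := rfl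

/-- Reindexing is injective. [folklore] -/
theorem piReindexHom_injective (T : Type*) [Fintype T] :
    Function.Injective (piReindexHom (G := G) T) := by
  intro f g h
  funext t
  have := congr_fun h (Fintype.equivFin T t)
  simpa [piReindexHom, Equiv.symm_apply_apply] using this

/-- **Slice rank of the powers bounds matchings in `((G^N)^3)^{N'}`**: if
`slice-rank D_{G^M} ≤ |G|^{M(1-δ)}` for all `M ≥ 1` (over some field), then every multiplicative
matching in `((G^N)^3)^{N'}` has size `≤ 3 ((|G|^{1-δ})^{3N})^{N'}` (Prop. 2.10 after the
isomorphism `((G^N)^3)^{N'} ≅ G^{3NN'}`; the factor `3` only absorbs the trivial cases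
`N = 0`, `N' = 0`). [cite: BlasiakChurchCohnGrochowUmans2017, Prop. 2.10 and Cor. 2.11] -/
theorem card_le_of_sliceRank_pow_le {G : Type} [Group G] [Fintype G] [DecidableEq G]
    {K : Type} [Field K] {δ : ℝ}
    (hsr : ∀ M : ℕ, 1 ≤ M →
      (sliceRank (mulGroupTensor K (Fin M → G)) : ℝ) ≤
        (Fintype.card G : ℝ) ^ ((M : ℝ) * (1 - δ)))
    (N N' : ℕ) (ι' : Type) [Fintype ι']
    (s t u : ι' → (Fin N' → (Fin N → G) × (Fin N → G) × (Fin N → G)))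
    (h : IsMulMatching s t u) :
    (Fintype.card ι' : ℝ) ≤ 3 * (((Fintype.card G : ℝ) ^ (1 - δ)) ^ (3 * N)) ^ N' := by
  have hGpos : (0 : ℝ) < Fintype.card G := by exact_mod_cast Fintype.card_pos
  have hY : 0 < (Fintype.card G : ℝ) ^ (1 - δ) := Real.rpow_pos_of_pos hGpos _
  rcases Nat.eq_zero_or_pos N with hN | hN
  · subst hN
    have h1 : Fintype.card ι' ≤ 1 := h.card_le_one
    have h1' : (Fintype.card ι' : ℝ) ≤ 1 := by exact_mod_cast h1
    simp only [mul_zero, pow_zero, one_pow, mul_one]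
    linarith
  rcases Nat.eq_zero_or_pos N' with hN' | hN'
  · subst hN'
    have h1 : Fintype.card ι' ≤ 1 := h.card_le_one
    have h1' : (Fintype.card ι' : ℝ) ≤ 1 := by exact_mod_cast h1
    simp only [pow_zero, mul_one]
    linarith
  -- transport the matching to `G^{Fin M}`, `M = N' (N + N + N)`
  set T := Fin N' × ((Fin N ⊕ Fin N) ⊕ Fin N) with hT
  set φ := (piReindexHom (G := G) T).comp (piProdThreeHom N N') with hφ
  have hφ : Function.Injective φ :=
    (piReindexHom_injective T).comp (piProdThreeHom_injective N N')
  have hM := (h.map φ hφ).card_le_sliceRank (K := K)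
  have hcardT : Fintype.card T = N' * (3 * N) := by
    simp only [hT, Fintype.card_prod, Fintype.card_sum, Fintype.card_fin]; ring
  have hMge : 1 ≤ Fintype.card T := by
    rw [hcardT]; exact Nat.one_le_iff_ne_zero.2 (Nat.mul_ne_zero hN'.ne' (by omega))
  have h2 := hsr (Fintype.card T) hMge
  have hM' : (Fintype.card ι' : ℝ) ≤ (sliceRank (mulGroupTensor K (Fin (Fintype.card T) → G)) : ℝ) := by
    exact_mod_cast hM
  have h3 : (Fintype.card G : ℝ) ^ ((Fintype.card T : ℝ) * (1 - δ)) =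
      (((Fintype.card G : ℝ) ^ (1 - δ)) ^ (3 * N)) ^ N' := by
    rw [hcardT, mul_comm ((N' * (3 * N) : ℕ) : ℝ), Real.rpow_mul_natCast hGpos.le, ← pow_mul,
      mul_comm N']
  calc (Fintype.card ι' : ℝ) ≤ _ := hM'
    _ ≤ _ := h2
    _ = (((Fintype.card G : ℝ) ^ (1 - δ)) ^ (3 * N)) ^ N' := h3
    _ ≤ 3 * (((Fintype.card G : ℝ) ^ (1 - δ)) ^ (3 * N)) ^ N' := by
        have : 0 ≤ (((Fintype.card G : ℝ) ^ (1 - δ)) ^ (3 * N)) ^ N' := by positivity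
        linarith

end Powers

/-! ## `|G| ≤ Σⱼ dⱼ^w` for `w ≥ 2`, and Corollary 2.11 -/

section Cor211

/-- `|G| = Σⱼ dⱼ² ≤ Σⱼ dⱼ^w` for `w ≥ 2` (Wedderburn blocks of `ℂ[G]`, `WedderburnBlocks.lean`).
[cite: CohnUmans2003, §1.3] -/
theorem card_le_charDegreePowSum (G : Type) [Group G] [Fintype G] {w : ℝ} (hw : 2 ≤ w) :
    (Fintype.card G : ℝ) ≤ charDegreePowSum G w := by
  obtain ⟨r, d, hd, ⟨φ⟩⟩ := exists_algEquiv_pi_matrix G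
  haveI : ∀ i, NeZero (d i) := hd
  have h1 := sum_blockDegrees_rpow_le_charDegreePowSum φ w
  have h2 := sum_sq_blockDegrees_eq_card φ
  rw [Nat.card_eq_fintype_card] at h2
  calc (Fintype.card G : ℝ) = ∑ i, ((d i : ℝ)) ^ (2 : ℝ) := by
        rw [← h2]; push_cast
        exact Finset.sum_congr rfl fun i _ => by rw [Real.rpow_two]
    _ ≤ ∑ i, (d i : ℝ) ^ w := Finset.sum_le_sum fun i _ =>
        Real.rpow_le_rpow_of_exponent_le (by exact_mod_cast NeZero.one_le) hw
    _ ≤ charDegreePowSum G w := h1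

/-- `m^{2δ/3} ≤ |G|^δ` when `m² ≤ |G|³`. [folklore] -/
theorem rpow_two_mul_div_three_le {m g : ℕ} (h : m ^ 2 ≤ g ^ 3) {δ : ℝ} (hδ : 0 ≤ δ) :
    ((m : ℝ)) ^ (2 * δ / 3) ≤ (g : ℝ) ^ δ := by
  have h' : ((m : ℝ)) ^ (2 : ℝ) ≤ (g : ℝ) ^ (3 : ℝ) := by
    rw [show (2 : ℝ) = ((2 : ℕ) : ℝ) by norm_num, show (3 : ℝ) = ((3 : ℕ) : ℝ) by norm_num,
      Real.rpow_natCast, Real.rpow_natCast]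
    exact_mod_cast h
  calc ((m : ℝ)) ^ (2 * δ / 3) = (((m : ℝ)) ^ (2 : ℝ)) ^ (δ / 3) := by
        rw [← Real.rpow_mul (Nat.cast_nonneg _)]; ring_nf
    _ ≤ ((g : ℝ) ^ (3 : ℝ)) ^ (δ / 3) := Real.rpow_le_rpow (by positivity) h' (by positivity)
    _ = (g : ℝ) ^ δ := by
        rw [← Real.rpow_mul (Nat.cast_nonneg _)]; ring_nf

/-- **From `Σ mᵢ^{2/3} ≤ |G|^{1-δ}` to inequality (2.2) at `w = 2 + 2δ`**: the per-triple packing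
`mᵢ² ≤ |G|³` gives `mᵢ^{(2+2δ)/3} ≤ mᵢ^{2/3} |G|^{δ}`, and `|G| ≤ Σⱼ dⱼ^{2+2δ}` (the step
"Thm. 2.8", BCCGNSU Lemma 2.4, in the form the tree's Thm. B proof uses).
[cite: BlasiakChurchCohnGrochowUmans2017, Thm. 2.8] -/
theorem sum_rpow_le_charDegreePowSum_of_sum_rpow_le {G : Type} [Group G] [Fintype G]
    [DecidableEq G] {δ : ℝ} (hδ : 0 < δ) {ι₀ : Type} [Fintype ι₀] {A B C : ι₀ → Finset G}
    (hS : SimultaneousTPP A B C)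
    (hsum : ∑ i, (((A i).card * (B i).card * (C i).card : ℕ) : ℝ) ^ ((2 : ℝ) / 3) ≤
      (Fintype.card G : ℝ) ^ (1 - δ)) :
    ∑ i, (((A i).card * (B i).card * (C i).card : ℕ) : ℝ) ^ ((2 + 2 * δ) / 3) ≤
      charDegreePowSum G (2 + 2 * δ) := by
  have hGpos : (0 : ℝ) < Fintype.card G := by exact_mod_cast Fintype.card_pos
  have hexp_eq : (2 + 2 * δ) / 3 = (2 : ℝ) / 3 + 2 * δ / 3 := by ring
  rw [hexp_eq]
  calc ∑ i, (((A i).card * (B i).card * (C i).card : ℕ) : ℝ) ^ ((2 : ℝ) / 3 + 2 * δ / 3)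
      = ∑ i, (((A i).card * (B i).card * (C i).card : ℕ) : ℝ) ^ ((2 : ℝ) / 3) *
          (((A i).card * (B i).card * (C i).card : ℕ) : ℝ) ^ (2 * δ / 3) := by
        refine Finset.sum_congr rfl fun i _ => ?_
        exact Real.rpow_add' (by positivity) (by positivity)
    _ ≤ ∑ i, (((A i).card * (B i).card * (C i).card : ℕ) : ℝ) ^ ((2 : ℝ) / 3) *
          (Fintype.card G : ℝ) ^ δ := by
        refine Finset.sum_le_sum fun i _ => ?_
        refine mul_le_mul_of_nonneg_left ?_ (by positivity)
        exact rpow_two_mul_div_three_le ((hS.1 i).card_mul_sq_le) hδ.le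
    _ = (Fintype.card G : ℝ) ^ δ *
          ∑ i, (((A i).card * (B i).card * (C i).card : ℕ) : ℝ) ^ ((2 : ℝ) / 3) := by
        rw [← Finset.sum_mul, mul_comm]
    _ ≤ (Fintype.card G : ℝ) ^ δ * (Fintype.card G : ℝ) ^ (1 - δ) := by gcongr
    _ = Fintype.card G := by
        rw [← Real.rpow_add hGpos]
        norm_num
    _ ≤ charDegreePowSum G (2 + 2 * δ) := card_le_charDegreePowSum G (by linarith)

/-- **BCCGU 2017, Corollary 2.11 ("Key corollary")**, discharged: `BCCGU2017_cor211` holds with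
`ε = 2δ`. Proof: matchings in `((G^N)^3)^{N'}` are bounded through the slice rank of
`D_{G^{3NN'}}` (`card_le_of_sliceRank_pow_le`, Prop. 2.10); the multiplicative BCCGNSU engine
(`SimultaneousTPP.sum_rpow_le_of_matching_bound`: Thm. 3.3, Lemma 3.4, Lemma 3.5, §3.2 = BCCGU
Thm. 2.9 made effective) gives `Σ mᵢ^{2/3} ≤ |G|^{1-δ}`; and the packing step
(`sum_rpow_le_charDegreePowSum_of_sum_rpow_le` = Thm. 2.8) gives (2.2) at `w = 2 + 2δ`.
[cite: BlasiakChurchCohnGrochowUmans2017, Cor. 2.11] -/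
theorem BCCGU2017_cor211_holds : BCCGU2017_cor211 := by
  intro δ hδ
  refine ⟨2 * δ, by positivity, ?_⟩
  intro G _ _ _ K _ hsr N S T U hS
  have hGpos : (0 : ℝ) < Fintype.card G := by exact_mod_cast Fintype.card_pos
  have hY : 0 < (Fintype.card G : ℝ) ^ (1 - δ) := Real.rpow_pos_of_pos hGpos _
  have hsum := SimultaneousTPP.sum_rpow_le_of_matching_bound hY
    (fun N₁ N' ι' _ s t u h => card_le_of_sliceRank_pow_le hsr N₁ N' ι' s t u h) hS
  have h := sum_rpow_le_charDegreePowSum_of_sum_rpow_le hδ hS hsum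
  convert h using 2

end Cor211


end Literature.Barriers.MatrixMultiplication

end
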